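import Summits.PneNP.PneNP.Theses.LatticeMagic
import Literature.Barriers.PneNP.LatticeGapCoNP

/-!
# Route LatticeMagic — support item `SanityFromNPHardness` (stmt-PneNP-10710)

The easy direction of "X ⟺ NP ≠ coNP" for the route's target X = "GapCVP_c ∉ PromiseCoNP for some
constant c ≥ 1": if GapCVP_c (as the promise problem
`PromiseProblem.ofEncoding gapCVPInstanceEncoding (GapCVP.yes _) (GapCVP.no _)`) is NP-hard under
deterministic Karp reductions for some constant `c ≥ 1` [Arora–Babai–Stern–Sweedyk 1997] and
`NP ≠ coNP`, then that same GapCVP_c is not in `PromiseCoNP`.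

Proof: an NP-hard promise problem inside `PromiseCoNP` gives `NP ⊆ coNP` (every `L ∈ NP` is the
`FP`-preimage of the separating `coNP` language; `coNP` is closed under polynomial-time preimages),
hence `NP = coNP` by complementation — the tree theorem
`Literature.Barriers.PneNP.np_eq_coNP_of_isNPHard_of_mem_PromiseCoNP`
[Aharonov–Regev 2005, App. B, p. 14], contradicting the second hypothesis.

The NP-hardness enters as a HYPOTHESIS of the item (it is in fact proved in the tree for every
rational constant `c > 1`, `Literature.Algebra.EuclideanLattices.isNPHard_gapCVPPromise_const`, but
the item does not ask for it).
-/

namespace Summit.PneNP.PneNP.Theorems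

/-- **`SanityFromNPHardness` holds** (route `LatticeMagic`, item stmt-PneNP-10710): if GapCVP_c is
NP-hard (Karp, as a promise problem) for some constant `c ≥ 1` and `NP ≠ coNP`, then for some
constant `c ≥ 1` (the same one) GapCVP_c ∉ PromiseCoNP. From
`Literature.Barriers.PneNP.np_eq_coNP_of_isNPHard_of_mem_PromiseCoNP` (an NP-hard promise problem in
`PromiseCoNP` forces `NP = coNP`) [Aharonov–Regev 2005, App. B; Arora et al. 1997]. -/
theorem sanityFromNPHardness_proof :
    Summit.PneNP.PneNP.Theses.LatticeMagic.SanityFromNPHardness := by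
  unfold Summit.PneNP.PneNP.Theses.LatticeMagic.SanityFromNPHardness
  rintro ⟨c, hc, hhard⟩ hne
  exact ⟨c, hc, fun hco =>
    hne (Literature.Barriers.PneNP.np_eq_coNP_of_isNPHard_of_mem_PromiseCoNP hco hhard)⟩

end Summit.PneNP.PneNP.Theorems
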